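import Summits.BirchSwinnertonDyer.BirchSwinnertonDyer.Theorems.ErratumRoadFiveNonSurjCornerTwinMuAnIndexParity
import Summits.BirchSwinnertonDyer.BirchSwinnertonDyer.Theorems.ErratumRoadFiveNonSurjCornerTwinMuAnSplitLinearCoefficient
import Summits.BirchSwinnertonDyer.BirchSwinnertonDyer.Theorems.ErratumRoadFiveNonSurjCornerTamagawaExponent
import HarnessLib

/-!
# Route `ErratumRoadFive`, crux 19065 `NonSurjCorner`, child 19948 `NonSurjCornerTwinMuAn`: the split-branch certificate
# index is `≥ 3` on EVERY split corner twin — the binder «`p` is the only split place» REMOVED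
# (cell `bsd-stepL`, seat `bsd-stepL-corner5-p2` g7; `--supports 19948 --as helper`)

Lane B g6's split-branch bound (`MuAnUnit.norm_coeff_one_C_mul_eq_bsd`, p583928: `‖[T¹](ϖ·L)‖_p = p·‖log_p q_E‖·‖#Ш_an‖`,
hence `two_le_of_norm_coeff_eq_one`) carries the binder `huniq` «`p` is the ONLY split multiplicative place of `Wd`», under
which the Tamagawa product is `c_p = ord_p Δ_min` up to `p`-adic units and the identity is EXACT. On a twin with further
split places (the multi-carrier profiles of the corner zoo: T17o7, T18o7d6, T8o7d5, T54o7d3 at 7; (84960d1, 5), …) the extra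
Tamagawa numbers only ADD `p`-adic valuation: `ord_p ∏c ≥ ord_p c_p = ord_p(ord_p Δ_min)`
(`CornerLocal.padicValNat_ordMinimalDiscriminant_le_padicValNat_tamagawaProduct`, g4), so the identity survives as the
INEQUALITY `‖[T¹](ϖ·L)‖_p ≤ p·‖log_p q_E‖_p·‖#Ш(Wd)_an‖_p` with NO hypothesis on the other places. With the corner's
`p`-th-power Tate parameter (g3/g6: `‖log_p q_E‖ ≤ p⁻²`) this gives `‖[T¹]‖ ≤ ‖#Ш_an‖/p`, index `≥ 2` for `p`-integral
`#Ш_an`, and with the parity law of `…TwinMuAnIndexParity` (this seat, §1–§3 there) **index `≥ 3` and odd on every split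
corner twin**.

* §1 `norm_coeff_one_C_mul_le_bsd` — the inequality (GZK + Greenberg–Stevens by name; no `huniq`);
* §2 `norm_coeff_one_C_mul_le_of_pow_anyCarrier`, `padicValRat_shaAn_le_of_norm_coeff_one_eq_one_anyCarrier`,
  `two_le_of_norm_coeff_eq_one_anyCarrier`;
* §3 corner forms with the `p`-th power discharged (`TateParameterData.exists_pow_eq_q_of_irr_of_not_surj`, g6) and the
  parity law: `NonSurjTwin.two_le_of_norm_coeff_eq_one_anyCarrier`, `NonSurjTwin.three_le_firstUnitCoeff_of_split_anyCarrier`,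
  `NonSurjTwin.three_le_find_of_split_anyCarrier` (Wuthrich Cor. 18 + modularity by name for the `Nat.find` form).

HONEST FRAMING: theorems only (no definition, no named fact, no `sorry`); conditional on GZK, Greenberg–Stevens, modularity
and (§3, `Nat.find` form) Wuthrich Cor. 18 BY NAME, and on the displayed per-twin binders (`shaAn Wd = q`, `ord_p q ≥ 0`);
a statement about WHERE the certificate can sit; 19948 does NOT close; BSD is advanced for no class (T7).
References: [MazurTateTeitelbaum1986Invent] §I.15, §I.17–18; [GreenbergStevens1993] Thm. 7.1; [SkinnerZhang2014] Thm. 1.3 (c);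
[SilvermanATAEC1994] Cor. IV.9.2 (d); tree: p583928, p584834, p556060 (g4), this seat's `…TwinMuAnIndexParity`.
-/

set_option autoImplicit false
set_option linter.dupNamespace false

noncomputable section

open scoped Classical NumberField MatrixGroups ModularForm

namespace Summit.BirchSwinnertonDyer.Rank1Residual.X11b.MuAnUnit

open CongruenceSubgroup WeierstrassCurve Literature.NumberTheory.EllipticCurves
  Literature.NumberTheory.EllipticCurves.ModularForms Literature.NumberTheory.EllipticCurves.Rank1Residual
  Summit.BirchSwinnertonDyer.Rank1Residual IsDedekindDomain

variable {N : ℕ} [NeZero N] {f : CuspForm (Gamma0 N) 2} {p : ℕ} [Fact p.Prime]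
  {Wd : WeierstrassCurve ℚ} [Wd.IsElliptic] [Wd.IsGloballyMinimal]

/-! ### §1 The linear coefficient in BSD invariants, any set of split places -/

/-- **`‖[T¹](ϖ·L)‖_p ≤ p·‖log_p q_E‖_p·‖#Ш(Wd)_an‖_p`** on an X11a twin (`r_an = 0`, `p ≥ 5`, `E[p]` irreducible) with Tate
datum `Dq` at the SPLIT prime `p`, newform `f`, period ratio `ϖ`, `L` with `IsMultPAdicLFunctionOf f p 1 L`, `shaAn Wd = q ≠ 0`;
modulo GZK (`hGZK`) and Greenberg–Stevens (`hGS`) by name — WITHOUT the binder «`p` is the only split place» of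
`norm_coeff_one_C_mul_eq_bsd`: `ord_p ∏c ≥ ord_p c_p = ord_p(ord_p Δ_min)` absorbs the `𝓛`-invariant's denominator, the other
Tamagawa numbers only add valuation, `#tors` is prime to `p`. [cite: Kobayashi2006DocMath, Cor. 4.2 (p. 575)]
[cite: MazurTateTeitelbaum1986Invent, §II.1] [cite: SilvermanATAEC1994, Cor. IV.9.2 (d)] -/
theorem norm_coeff_one_C_mul_le_bsd (hp2 : p ≠ 2) (hGZK : rank_eq_analyticRank_of_analyticRank_le_one)
    (hXa : ClassX11a Wd p) (hGS : greenberg_stevens (W := Wd) (p := p)) (Dq : TateParameterData Wd p)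
    (hf : IsNewformOf Wd f) {ϖ : ℚ} (hϖ : (ϖ : ℝ) * Wd.realPeriodRat = plusPeriod f)
    {L : PowerSeries ℚ_[p]} (hL : IsMultPAdicLFunctionOf f p 1 L) {q : ℚ} (hq : shaAn Wd = (q : ℂ)) (hq0 : q ≠ 0) :
    ‖PowerSeries.coeff 1 (PowerSeries.C ((ϖ : ℚ) : ℚ_[p]) * L)‖ ≤
      (p : ℝ) * (‖padicLog p Dq.q‖ * ‖((q : ℚ) : ℚ_[p])‖) := by
  have hpP : p.Prime := Fact.out
  -- the place of `p` and the split reduction there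
  set v₀ : HeightOneSpectrum (𝓞 ℚ) := (Rat.HeightOneSpectrum.primesEquiv (R := 𝓞 ℚ)).symm ⟨p, Fact.out⟩ with hv₀
  have hpv : ((Rat.HeightOneSpectrum.primesEquiv v₀ : Nat.Primes) : ℕ) = p := by rw [hv₀, Equiv.apply_symm_apply]
  have hs₀ : Wd.HasSplitMultiplicativeReductionAt v₀ :=
    (Wd.hasSplitMultiplicativeReductionAtPrime_iff_hasSplitMultiplicativeReductionAt v₀).mp
      (Summit.BirchSwinnertonDyer.BirchSwinnertonDyer.Theorems.CornerSeven.T54o7.hasSplitMultiplicativeReductionAtPrime_of_eq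
        hpv.symm Dq.split)
  -- `ord_p (ord_p Δ_min) ≤ ord_p Tam`
  set e : ℕ := padicValInt p Wd.minimalDiscriminantInt with he
  have hTam : padicValNat p e ≤ padicValNat p Wd.tamagawaProduct := by
    have h := Summit.BirchSwinnertonDyer.BirchSwinnertonDyer.Theorems.CornerLocal.padicValNat_ordMinimalDiscriminant_le_padicValNat_tamagawaProduct
      Wd p hs₀
    rwa [Summit.BirchSwinnertonDyer.BirchSwinnertonDyer.Theorems.CornerLocal.ordMinimalDiscriminant_eq_padicValInt_primesEquiv
      Wd v₀, hpv] at h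
  -- `ord_p q_E = e ≥ 1`
  have hval : Dq.q.valuation = (e : ℤ) := TateParameterData.valuation_q_eq_padicValInt_holds Dq
  have he0 : e ≠ 0 := by
    intro h0
    have := Dq.valuation_q_pos
    rw [hval, h0] at this
    simp at this
  have heQ : ((e : ℚ) : ℚ_[p]) = (Dq.q.valuation : ℚ_[p]) := by rw [hval]; push_cast; rfl
  have heQ0 : (e : ℚ) ≠ 0 := by exact_mod_cast he0
  -- tors is prime to `p`
  have ht0 : padicValNat p Wd.torsionOrder = 0 := padicValNat_torsionOrder_eq_zero_of_irreducible Wd p hXa.2.2.2.1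
  have htq : (Wd.torsionOrder : ℚ) ≠ 0 := by exact_mod_cast (Wd.torsionOrder_pos_holds).ne'
  have hcq : (Wd.tamagawaProduct : ℚ) ≠ 0 := by exact_mod_cast (Wd.tamagawaProduct_pos').ne'
  -- `ϖ·[0]⁺ = q·Tam/tors²`
  have hid := varpi_mul_ratPlusSymbol_eq hGZK hXa.1 hf hϖ hq
  -- the rational `s = q·Tam/(tors²·e)` and its valuation `≥ ord_p q`
  set s : ℚ := q * Wd.tamagawaProduct / (Wd.torsionOrder : ℚ) ^ 2 / e with hs
  have hs0 : s ≠ 0 := div_ne_zero (div_ne_zero (mul_ne_zero hq0 hcq) (pow_ne_zero 2 htq)) heQ0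
  have hvs : padicValRat p q ≤ padicValRat p s := by
    rw [hs, padicValRat.div (div_ne_zero (mul_ne_zero hq0 hcq) (pow_ne_zero 2 htq)) heQ0,
      padicValRat.div (mul_ne_zero hq0 hcq) (pow_ne_zero 2 htq), padicValRat.mul hq0 hcq, padicValRat.pow,
      show (Wd.tamagawaProduct : ℚ) = ((Wd.tamagawaProduct : ℕ) : ℚ) by norm_cast, padicValRat.of_nat,
      show (Wd.torsionOrder : ℚ) = ((Wd.torsionOrder : ℕ) : ℚ) by norm_cast, padicValRat.of_nat, ht0,
      show (e : ℚ) = ((e : ℕ) : ℚ) by norm_cast, padicValRat.of_nat]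
    push_cast
    have hT : ((padicValNat p e : ℕ) : ℤ) ≤ ((padicValNat p Wd.tamagawaProduct : ℕ) : ℤ) := by exact_mod_cast hTam
    linarith
  have hns : ‖((s : ℚ) : ℚ_[p])‖ ≤ ‖((q : ℚ) : ℚ_[p])‖ := by
    rw [Padic.eq_padicNorm, Padic.eq_padicNorm, padicNorm.eq_zpow_of_nonzero hs0, padicNorm.eq_zpow_of_nonzero hq0]
    have hp1 : (1 : ℚ) ≤ p := by exact_mod_cast hpP.one_lt.le
    exact_mod_cast zpow_le_zpow_right₀ hp1 (neg_le_neg hvs)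
  -- rewrite `ϖ·𝓛·[0]⁺ = log_p q · s`
  have hkey : ((ϖ : ℚ) : ℚ_[p]) * LInvariant Dq * (ratPlusSymbol f 0 : ℚ_[p]) = padicLog p Dq.q * ((s : ℚ) : ℚ_[p]) := by
    have hϖs : ((ϖ : ℚ) : ℚ_[p]) * (ratPlusSymbol f 0 : ℚ_[p]) = (((q * Wd.tamagawaProduct / (Wd.torsionOrder : ℚ) ^ 2 : ℚ)) : ℚ_[p]) := by
      rw [← Rat.cast_mul, hid]
    have heP : (Dq.q.valuation : ℚ_[p]) ≠ 0 := by rw [← heQ]; exact_mod_cast heQ0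
    rw [WeierstrassCurve.LInvariant, hs]
    rw [show ((q * ↑Wd.tamagawaProduct / (Wd.torsionOrder : ℚ) ^ 2 / (e : ℚ) : ℚ) : ℚ_[p]) =
        ((q * ↑Wd.tamagawaProduct / (Wd.torsionOrder : ℚ) ^ 2 : ℚ) : ℚ_[p]) / ((e : ℚ) : ℚ_[p]) by push_cast; ring,
      ← hϖs, heQ]
    field_simp
  rw [norm_coeff_one_C_mul_of_one hp2 hGS Dq hf hL, hkey, norm_mul]
  have hp0 : (0 : ℝ) ≤ p := by positivity
  exact mul_le_mul_of_nonneg_left (mul_le_mul_of_nonneg_left hns (norm_nonneg _)) hp0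

/-! ### §2 A `p`-th power Tate parameter: `[T¹]` is never the certificate, any set of split places -/

/-- **`‖[T¹](ϖ·L)‖_p ≤ p⁻¹·‖#Ш(Wd)_an‖_p`** under the hypotheses of `norm_coeff_one_C_mul_le_bsd` PLUS «the Tate parameter is
a `p`-th power in `ℚ_p`» (`hpow`); no «only split place» binder. [cite: SkinnerZhang2014, Thm. 1.3 (c)] [cite: Iwasawa1972PadicL, §4.4] -/
theorem norm_coeff_one_C_mul_le_of_pow_anyCarrier (hp2 : p ≠ 2) (hGZK : rank_eq_analyticRank_of_analyticRank_le_one)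
    (hXa : ClassX11a Wd p) (hGS : greenberg_stevens (W := Wd) (p := p)) (Dq : TateParameterData Wd p)
    (hpow : ∃ r : ℚ_[p], r ^ p = Dq.q)
    (hf : IsNewformOf Wd f) {ϖ : ℚ} (hϖ : (ϖ : ℝ) * Wd.realPeriodRat = plusPeriod f)
    {L : PowerSeries ℚ_[p]} (hL : IsMultPAdicLFunctionOf f p 1 L) {q : ℚ} (hq : shaAn Wd = (q : ℂ)) (hq0 : q ≠ 0) :
    ‖PowerSeries.coeff 1 (PowerSeries.C ((ϖ : ℚ) : ℚ_[p]) * L)‖ ≤ (p : ℝ)⁻¹ * ‖((q : ℚ) : ℚ_[p])‖ := by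
  obtain ⟨r, hr⟩ := hpow
  have hr0 : r ≠ 0 := by rintro rfl; exact Dq.q_ne_zero (by rw [← hr, zero_pow (Fact.out : p.Prime).ne_zero])
  have hlog : ‖padicLog p Dq.q‖ ≤ (p : ℝ)⁻¹ * (p : ℝ)⁻¹ := by rw [← hr]; exact norm_padicLog_pow_prime_le hp2 hr0
  have hp0 : (0 : ℝ) < p := by exact_mod_cast (Fact.out : p.Prime).pos
  calc ‖PowerSeries.coeff 1 (PowerSeries.C ((ϖ : ℚ) : ℚ_[p]) * L)‖
      ≤ (p : ℝ) * (‖padicLog p Dq.q‖ * ‖((q : ℚ) : ℚ_[p])‖) :=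
        norm_coeff_one_C_mul_le_bsd hp2 hGZK hXa hGS Dq hf hϖ hL hq hq0
    _ ≤ (p : ℝ) * ((p : ℝ)⁻¹ * (p : ℝ)⁻¹ * ‖((q : ℚ) : ℚ_[p])‖) :=
        mul_le_mul_of_nonneg_left (mul_le_mul_of_nonneg_right hlog (norm_nonneg _)) hp0.le
    _ = (p : ℝ)⁻¹ * ‖((q : ℚ) : ℚ_[p])‖ := by field_simp

/-- **A unit linear coefficient forces `ord_p #Ш(Wd)_an ≤ −1`**, any set of split places. [cite: SkinnerZhang2014, Thm. 1.3 (c)] -/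
theorem padicValRat_shaAn_le_of_norm_coeff_one_eq_one_anyCarrier (hp2 : p ≠ 2)
    (hGZK : rank_eq_analyticRank_of_analyticRank_le_one) (hXa : ClassX11a Wd p)
    (hGS : greenberg_stevens (W := Wd) (p := p)) (Dq : TateParameterData Wd p) (hpow : ∃ r : ℚ_[p], r ^ p = Dq.q)
    (hf : IsNewformOf Wd f) {ϖ : ℚ} (hϖ : (ϖ : ℝ) * Wd.realPeriodRat = plusPeriod f)
    {L : PowerSeries ℚ_[p]} (hL : IsMultPAdicLFunctionOf f p 1 L) {q : ℚ} (hq : shaAn Wd = (q : ℂ)) (hq0 : q ≠ 0)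
    (h1 : ‖PowerSeries.coeff 1 (PowerSeries.C ((ϖ : ℚ) : ℚ_[p]) * L)‖ = 1) : padicValRat p q ≤ -1 := by
  have hle := norm_coeff_one_C_mul_le_of_pow_anyCarrier hp2 hGZK hXa hGS Dq hpow hf hϖ hL hq hq0
  rw [h1, Padic.eq_padicNorm, padicNorm.eq_zpow_of_nonzero hq0] at hle
  push_cast at hle
  have hp1 : (1 : ℝ) < p := by exact_mod_cast (Fact.out : p.Prime).one_lt
  have h' : (p : ℝ) ^ (1 : ℤ) ≤ (p : ℝ) ^ (-padicValRat p q) := by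
    rw [zpow_one]
    have hp0 : (0 : ℝ) < p := by linarith
    calc (p : ℝ) = p * 1 := (mul_one _).symm
      _ ≤ p * ((p : ℝ)⁻¹ * (p : ℝ) ^ (-padicValRat p q)) := mul_le_mul_of_nonneg_left hle hp0.le
      _ = (p : ℝ) ^ (-padicValRat p q) := by field_simp
  have := (zpow_le_zpow_iff_right₀ hp1).mp h'
  omega

/-- **On the split branch the certificate index is at least `2`, any set of split places** (`ord_p #Ш(Wd)_an ≥ 0`):
`‖[Tⁿ](ϖ·L)‖ = 1 ⟹ 2 ≤ n`. [cite: MazurTateTeitelbaum1986Invent, §I.15] [cite: SkinnerZhang2014, Thm. 1.3 (c)] -/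
theorem two_le_of_norm_coeff_eq_one_anyCarrier (hp2 : p ≠ 2) (hGZK : rank_eq_analyticRank_of_analyticRank_le_one)
    (hXa : ClassX11a Wd p) (hGS : greenberg_stevens (W := Wd) (p := p)) (Dq : TateParameterData Wd p)
    (hpow : ∃ r : ℚ_[p], r ^ p = Dq.q)
    (hf : IsNewformOf Wd f) {ϖ : ℚ} (hϖ : (ϖ : ℝ) * Wd.realPeriodRat = plusPeriod f)
    {L : PowerSeries ℚ_[p]} (hL : IsMultPAdicLFunctionOf f p 1 L) {q : ℚ} (hq : shaAn Wd = (q : ℂ)) (hq0 : q ≠ 0)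
    (hint : 0 ≤ padicValRat p q) {n : ℕ} (hn : ‖PowerSeries.coeff n (PowerSeries.C ((ϖ : ℚ) : ℚ_[p]) * L)‖ = 1) : 2 ≤ n := by
  rcases Nat.lt_or_ge n 2 with hlt | hge
  · exfalso
    interval_cases n
    · rw [coeff_zero_C_mul_of_one hL, norm_zero] at hn; exact zero_ne_one hn
    · have := padicValRat_shaAn_le_of_norm_coeff_one_eq_one_anyCarrier hp2 hGZK hXa hGS Dq hpow hf hϖ hL hq hq0 hn
      omega
  · exact hge

end Summit.BirchSwinnertonDyer.Rank1Residual.X11b.MuAnUnit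

/-! ### §3 Corner forms: the `p`-th power discharged, and the parity law -/

namespace Summit.BirchSwinnertonDyer.BirchSwinnertonDyer.Theorems.TatePow

open CongruenceSubgroup PowerSeries WeierstrassCurve IsDedekindDomain Rat.HeightOneSpectrum
  Literature.NumberTheory.EllipticCurves Literature.NumberTheory.EllipticCurves.ModularForms
  Literature.NumberTheory.EllipticCurves.Rank1Residual Summit.BirchSwinnertonDyer.Rank1Residual
  Summit.BirchSwinnertonDyer.Rank1Residual.X11b.MuAnUnit

variable {W : WeierstrassCurve ℚ} [W.IsElliptic] [W.IsGloballyMinimal] {p : ℕ} [Fact p.Prime]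
  {N : ℕ} [NeZero N] {f : CuspForm (Gamma0 N) 2}

/-- **On every split corner twin the certificate index is `≥ 2`** (for `p`-integral `#Ш(Wd)_an`): lane B g6's
`NonSurjTwin.two_le_of_norm_coeff_eq_one` with the binder «`p` the only split place» REMOVED (§2 + the `p`-th power from
`TateParameterData.exists_pow_eq_q_of_irr_of_not_surj`). [cite: MazurTateTeitelbaum1986Invent, §I.15] [cite: SkinnerZhang2014, Thm. 1.3 (c)] -/
theorem NonSurjTwin.two_le_of_norm_coeff_eq_one_anyCarrier (hGZK : rank_eq_analyticRank_of_analyticRank_le_one)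
    (hXa : ClassX11a W p) (hns : ¬ Surj W p) (h57 : p = 5 ∨ p = 7) (hGS : greenberg_stevens (W := W) (p := p))
    (Dq : TateParameterData W p) (hf : IsNewformOf W f) {ϖ : ℚ} (hϖ : (ϖ : ℝ) * W.realPeriodRat = plusPeriod f)
    {L : PowerSeries ℚ_[p]} (hL : IsMultPAdicLFunctionOf f p 1 L) {q : ℚ} (hq : shaAn W = (q : ℂ)) (hq0 : q ≠ 0)
    (hint : 0 ≤ padicValRat p q) {n : ℕ} (hn : ‖PowerSeries.coeff n (PowerSeries.C ((ϖ : ℚ) : ℚ_[p]) * L)‖ = 1) : 2 ≤ n := by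
  have hp2 : p ≠ 2 := by rcases h57 with rfl | rfl <;> decide
  exact Summit.BirchSwinnertonDyer.Rank1Residual.X11b.MuAnUnit.two_le_of_norm_coeff_eq_one_anyCarrier hp2 hGZK hXa hGS Dq
    (TateParameterData.exists_pow_eq_q_of_irr_of_not_surj W p hp2 hXa.2.2.1 hXa.2.2.2.1 hns Dq) hf hϖ hL hq hq0 hint hn

/-- **On every split corner twin the certificate index is `≥ 3` and ODD** — `NonSurjTwin.three_le_firstUnitCoeff_of_split`
(`…TwinMuAnIndexParity`) with the binder «`p` the only split place» REMOVED. [cite: MazurTateTeitelbaum1986Invent, §I.15, §I.17 and §I.18] -/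
theorem NonSurjTwin.three_le_firstUnitCoeff_of_split_anyCarrier (hmod : exists_isNewformOf)
    (hGZK : rank_eq_analyticRank_of_analyticRank_le_one) (hXa : ClassX11a W p) (hnsj : ¬ Surj W p)
    (h57 : p = 5 ∨ p = 7) (hsplit : W.HasSplitMultiplicativeReductionAtPrime p)
    (hGS : greenberg_stevens (W := W) (p := p)) (Dq : TateParameterData W p)
    (hf : IsNewformOf W f) {ϖ : ℚ} (hϖ : (ϖ : ℝ) * W.realPeriodRat = plusPeriod f)
    {L : PowerSeries ℚ_[p]} (hL : IsMultPAdicLFunctionOf f p 1 L) {q : ℚ} (hq : shaAn W = (q : ℂ)) (hq0 : q ≠ 0)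
    (hint : 0 ≤ padicValRat p q) {n : ℕ}
    (hsmall : ∀ j < n, ‖PowerSeries.coeff j (PowerSeries.C ((ϖ : ℚ) : ℚ_[p]) * L)‖ < 1)
    (hn : ‖PowerSeries.coeff n (PowerSeries.C ((ϖ : ℚ) : ℚ_[p]) * L)‖ = 1) : 3 ≤ n ∧ Odd n := by
  have h2 := NonSurjTwin.two_le_of_norm_coeff_eq_one_anyCarrier hGZK hXa hnsj h57 hGS Dq hf hϖ hL hq hq0 hint hn
  have hodd := NonSurjTwin.odd_firstUnitCoeff_of_split hmod hXa hsplit hf hL ((ϖ : ℚ) : ℚ_[p]) hsmall hn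
  refine ⟨?_, hodd⟩
  rcases Nat.lt_or_ge n 3 with hlt | hge
  · exfalso
    have h2n : n = 2 := by omega
    rw [h2n] at hodd
    exact absurd hodd (by decide)
  · exact hge

/-- **On every split corner twin the LEAST witness of `stub_twinMuAn_split`'s `∃ n` is `≥ 3` and odd** — the `Nat.find` form,
Wuthrich Cor. 18 and modularity by name; no «only split place» binder. [cite: Wuthrich2014, Cor. 18 (p. 398)]
[cite: MazurTateTeitelbaum1986Invent, §I.15, §I.17 and §I.18] -/
theorem NonSurjTwin.three_le_find_of_split_anyCarrier
    (hWu : Wuthrich2014.corollary18_padicLFunction_mem_iwasawaAlgebra_multiplicative) (hmod : exists_isNewformOf)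
    (hGZK : rank_eq_analyticRank_of_analyticRank_le_one) (hXa : ClassX11a W p) (hnsj : ¬ Surj W p)
    (h57 : p = 5 ∨ p = 7) (hsplit : W.HasSplitMultiplicativeReductionAtPrime p)
    (hGS : greenberg_stevens (W := W) (p := p)) (Dq : TateParameterData W p)
    (hf : IsNewformOf W f) {ϖ : ℚ} (hϖ : (ϖ : ℝ) * W.realPeriodRat = plusPeriod f)
    {L : PowerSeries ℚ_[p]} (hL : IsMultPAdicLFunctionOf f p 1 L) {q : ℚ} (hq : shaAn W = (q : ℂ)) (hq0 : q ≠ 0)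
    (hint : 0 ≤ padicValRat p q)
    (h : ∃ n : ℕ, ‖PowerSeries.coeff n (PowerSeries.C ((ϖ : ℚ) : ℚ_[p]) * L)‖ = 1) :
    3 ≤ Nat.find h ∧ Odd (Nat.find h) := by
  obtain ⟨G, hG⟩ := (hWu W p hXa.2.1 hXa.2.2.1 hf ϖ hϖ).2 hsplit L ((isMultPAdicLFunctionOf_one_iff L).mp hL)
  have hle := (exists_iwasawaToPowerSeries_eq_iff_norm_coeff_le_one _).mp ⟨G, hG⟩
  exact NonSurjTwin.three_le_firstUnitCoeff_of_split_anyCarrier hmod hGZK hXa hnsj h57 hsplit hGS Dq hf hϖ hL hq hq0 hint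
    (NonSurjTwin.norm_coeff_lt_one_of_lt_find hle h) (Nat.find_spec h)

end Summit.BirchSwinnertonDyer.BirchSwinnertonDyer.Theorems.TatePow

end
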